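import Literature.AlgebraicGeometry.ModuliOfAbelianVarieties.SiegelCanonicalModel
import HarnessLib

/-!
# The reciprocity law (62) of a `ℚ`-model of the Siegel tower descends along the level maps `K ≤ K′`:
# `IsCanonical` is the law at any COINITIAL family of principal levels ([Deligne 1971] Déf. 3.1/3.13; [Milne ISV] Thm. 13.6)

Topic `AlgebraicGeometry/ModuliOfAbelianVarieties`; namespace `Literature.AlgebraicGeometry.ModuliOfAbelianVarieties.SiegelRationalModel`.
THEOREMS ONLY (no definition, no named fact, no instance, no `sorry`; net Literature debt **0**).  Sequel of ★ (σ4)-D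
`SiegelCanonicalModel` (`SiegelRationalModel`, `ptQ`, `IsCanonical`).  Cell hodgecm-mathlib (D-0151), banked GENERIC leaf R60-25 toward
fan-B row I-7 (#60) `SiegelS1` (director g6 RULING s86 (2)(b); `MUMFORD-LINE-SPEC.md` §3: the future proof M3 may check (62) at the levels
of its choice).

WHAT IS PROVED.  For a `ℚ`-model `R` of a Siegel complex record system `Sg` (`R.Nm : SiegelLevel δ ⥤ SchemeOver ℚ`,
`R.e : Nm ⊗ ℂ ≅ Sg.Mc`):
* §1 `map_ptQ` — the `ℚ`-structure points are NATURAL in the level: for an arrow `f : K ⟶ K′` of the level poset (`K ≤ K′`),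
  `Nm(f)(ptQ_K P) = ptQ_{K′}(Mc(f) P)` (naturality of `e⁻¹` and of the base-change identification `X(ℂ) ≃ (X ⊗_ℚ ℂ)(ℂ)`,
  ★ `baseChangeHom_map_left_comp_fst`); `ptQ_symm_mk_map` — `Mc(f)` sends `[J, aK]` to `[J, aK′]` (the record's `map_pts`).
* §2 `reciprocity_of_hom` — for a fixed CM special pair `(c, J, Φ)` and field `E`: the (62) clause AT LEVEL `K` implies the clause AT
  EVERY COARSER LEVEL `K′ ≥ K` — push the identity `σ • ptQ_K[J,a] = ptQ_K[J, r·a]` forward along the `ℚ`-morphism `Nm(f)`, which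
  commutes with `σ` (★ `AlgPoints.map_smul`) and with `ptQ` (§1).
* §3 HEAD `isCanonical_iff_of_coinitial` — for any set `S` of levels that is COINITIAL (every level is `≥` some member of `S`; e.g.
  `{K_δ(N) : N₀ ∣ N}`), `R.IsCanonical ↔` the (62) clause at the levels in `S` only.  So a proof of #60's reciprocity may work at
  sufficiently divisible levels; and the typed `∀ L` is not stronger than print's tower-compatible formulation ([Deligne1971TravauxShimura]
  Déf. 3.1: the model carries the `G(𝔸_f)`-equivariant TOWER; [Milne2005ShimuraVarieties] Thm. 13.6: (62) is compatible with the maps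
  `Sh_{K} → Sh_{K′}`).
Nothing printed is asserted.  HC_CM is proved only modulo the 7 printed citations until rung 0 closes.

## References
* [Deligne1971TravauxShimura] P. Deligne, *Travaux de Shimura*, Sém. Bourbaki 389 (1971), 1.8 p. 129, Déf. 3.1 p. 136, Déf. 3.13 p. 141.
* [Milne2005ShimuraVarieties] J. S. Milne, *Introduction to Shimura varieties* (2005), §5 (inverse system `Sh_K`), Def. 12.8 (62) p. 114,
  Thm. 13.6 p. 118.
* [Hartshorne1977] R. Hartshorne, *Algebraic Geometry*, II.3 Thm. 3.3 (points of a fibre product).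
-/

set_option autoImplicit false

noncomputable section

open Matrix NumberField IsDedekindDomain CategoryTheory

namespace Literature.AlgebraicGeometry.ModuliOfAbelianVarieties

open Literature.AlgebraicGeometry.Motives (SchemeOver ComplexPoints AlgPoints CMType)
open Literature.NumberTheory.ComplexMultiplication (traceField)
open Literature.AlgebraicGeometry.ShimuraVarieties (UnitaryCanonicalModel.IsArtinCorrespondent)

namespace SiegelRationalModel

variable {g : ℕ} {δ : Fin g → ℕ} {Sg : SiegelComplexRecordSystem g δ} (R : SiegelRationalModel g δ Sg)

/-! ### §1. `ptQ` is natural in the level -/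

/-- The base-change identification `X(ℂ) ≃ (X ⊗_ℚ ℂ)(ℂ)` is natural in `X`: for a `ℚ`-morphism `φ : X ⟶ Y`,
`e_Y⁻¹ (φ_ℂ (Q)) = φ (e_X⁻¹ Q)` (both are `Q ≫ π_X ≫ φ` on underlying schemes, ★ `baseChangeHom_map_left_comp_fst`).
[cite: Hartshorne1977, II.3 Thm. 3.3] -/
theorem baseChangeEquiv_symm_map {X Y : SchemeOver ℚ} (φ : X ⟶ Y)
    (Q : ComplexPoints ((Motives.baseChange ℚ ℂ).obj X)) :
    (AlgPoints.baseChangeEquiv (algebraMap ℚ ℂ) Y).symm (AlgPoints.map ((Motives.baseChange ℚ ℂ).map φ) Q) =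
      AlgPoints.map φ ((AlgPoints.baseChangeEquiv (algebraMap ℚ ℂ) X).symm Q) := by
  apply Over.OverMorphism.ext
  have hnat : ((Motives.baseChange ℚ ℂ).map φ).left ≫ Motives.baseChangeHomFst (algebraMap ℚ ℂ) Y =
      Motives.baseChangeHomFst (algebraMap ℚ ℂ) X ≫ φ.left :=
    Motives.baseChangeHom_map_left_comp_fst (algebraMap ℚ ℂ) φ
  simp only [AlgPoints.baseChangeEquiv_symm_apply_left, AlgPoints.map, Over.comp_left, Category.assoc]
  erw [hnat]
  exact (Category.assoc _ _ _).symm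

/-- **`ptQ` is natural in the level**: for `f : K ⟶ K′` (`K ≤ K′`) and a complex point `P` of `Sg.Mc_K`,
`Nm(f) (ptQ_K P) = ptQ_{K′} (Mc(f) P)` — by the naturality of `e⁻¹ : Sg.Mc ≅ Nm ⊗ ℂ` and of the projection `(X ⊗ ℂ) ⟶ X`
(★ `baseChangeHom_map_left_comp_fst`), read on underlying morphisms of schemes.
[cite: Deligne1971TravauxShimura, Déf. 3.1 p. 136 (b) («isomorphisme … compatible»)] [cite: Milne2005ShimuraVarieties, §13 p. 117] -/
theorem map_ptQ {K K' : SiegelLevel δ} (f : K ⟶ K') (P : ComplexPoints (Sg.Mc.obj K)) :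
    AlgPoints.map (R.Nm.map f) (R.ptQ K P) = R.ptQ K' (AlgPoints.map (Sg.Mc.map f) P) := by
  apply Over.OverMorphism.ext
  have hnat : (Sg.Mc.map f).left ≫ (R.e.inv.app K').left =
      (R.e.inv.app K).left ≫ ((R.Nm ⋙ Motives.baseChange ℚ ℂ).map f).left := by
    rw [← Over.comp_left, ← Over.comp_left, R.e.inv.naturality f]
  have hfst : ((R.Nm ⋙ Motives.baseChange ℚ ℂ).map f).left ≫ Motives.baseChangeHomFst (algebraMap ℚ ℂ) (R.Nm.obj K') =
      Motives.baseChangeHomFst (algebraMap ℚ ℂ) (R.Nm.obj K) ≫ (R.Nm.map f).left :=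
    Motives.baseChangeHom_map_left_comp_fst (algebraMap ℚ ℂ) (R.Nm.map f)
  simp only [ptQ_def, AlgPoints.map, Over.comp_left, AlgPoints.baseChangeEquiv_symm_apply_left, Category.assoc]
  erw [reassoc_of% hnat, hfst]
  exact (Category.assoc _ _ _).trans (congrArg (fun t => Over.Hom.left P ≫ t) (Category.assoc _ _ _))

/-- **`Mc(f)` sends `[J, aK]` to `[J, aK′]`** read through `pts⁻¹` (the record's field `map_pts`, inverted).
[cite: Deligne1971TravauxShimura, 1.8 p. 129] [cite: Milne2005ShimuraVarieties, §5 p. 55 («Sh_{K} → Sh_{K′}»)] -/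
theorem ptsSymm_mk_eq_map (Sg : SiegelComplexRecordSystem g δ) {K K' : SiegelLevel δ} (f : K ⟶ K') (J : C0pm δ)
    (a : gspFinAdelic δ) :
    (Sg.pts K').symm (SiegelShimuraSet.mk δ K'.1 J a) =
      AlgPoints.map (Sg.Mc.map f) ((Sg.pts K).symm (SiegelShimuraSet.mk δ K.1 J a)) := by
  rw [Equiv.symm_apply_eq, Sg.map_pts K K' f J a]

/-! ### §2. (62) at level `K` implies (62) at every coarser level `K′` -/

variable {ι : Type} [Fintype ι] [DecidableEq ι] {K : ι → Type} [∀ i, Field (K i)] [∀ i, NumberField (K i)]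
  [∀ i, IsCMField (K i)]

/-- **The reciprocity law (62) DESCENDS ALONG THE LEVEL MAPS.**  Fix a CM special pair `(c, J, Φ)` and a number field `E ⊆ ℂ`.  If the
`ℚ`-model `R` satisfies the (62) clause of `IsCanonical` at the level `L` then it satisfies it at every level `L′` with `L ⟶ L′`
(`L ≤ L′`): `σ • ptQ_{L′}[J,a] = Nm(f)(σ • ptQ_L[J,a]) = Nm(f)(ptQ_L[J, r·a]) = ptQ_{L′}[J, r·a]`, because the `ℚ`-morphism `Nm(f)`
commutes with `σ ∈ Aut(ℂ/ℚ)` (★ `AlgPoints.map_smul`) and with `ptQ` (`map_ptQ`). Texts = the `IsCanonical` body at `L` and at `L′`.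
[cite: Milne2005ShimuraVarieties, Def. 12.8 (62) p. 114 and Thm. 13.6 p. 118] [cite: Deligne1971TravauxShimura, Déf. 3.13 p. 141] -/
theorem reciprocity_of_hom (c : CMStructure g δ ι K) (J : C0pm δ) (Φ : ∀ i, CMType (K i))
    (E : IntermediateField ℚ ℂ) [NumberField ↥E] {L L' : SiegelLevel δ} (f : L ⟶ L')
    (h : ∀ (σ : ℂ ≃ₐ[↥E] ℂ) (s : (FiniteAdeleRing (𝓞 ↥E) ↥E)ˣ),
      UnitaryCanonicalModel.IsArtinCorrespondent ↥E (algebraMap ↥E ℂ) s σ.toRingEquiv →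
      ∀ r : gspFinAdelic δ,
        ((r : GL (Fin g ⊕ Fin g) (FiniteAdeleRing (𝓞 ℚ) ℚ)) :
            Matrix (Fin g ⊕ Fin g) (Fin g ⊕ Fin g) (FiniteAdeleRing (𝓞 ℚ) ℚ)) = c.cmRecipMatrix Φ E s →
        ∀ a : gspFinAdelic δ,
          (σ.restrictScalars ℚ) • R.ptQ L ((Sg.pts L).symm (SiegelShimuraSet.mk δ L.1 J a)) =
            R.ptQ L ((Sg.pts L).symm (SiegelShimuraSet.mk δ L.1 J (r * a)))) :
    ∀ (σ : ℂ ≃ₐ[↥E] ℂ) (s : (FiniteAdeleRing (𝓞 ↥E) ↥E)ˣ),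
      UnitaryCanonicalModel.IsArtinCorrespondent ↥E (algebraMap ↥E ℂ) s σ.toRingEquiv →
      ∀ r : gspFinAdelic δ,
        ((r : GL (Fin g ⊕ Fin g) (FiniteAdeleRing (𝓞 ℚ) ℚ)) :
            Matrix (Fin g ⊕ Fin g) (Fin g ⊕ Fin g) (FiniteAdeleRing (𝓞 ℚ) ℚ)) = c.cmRecipMatrix Φ E s →
        ∀ a : gspFinAdelic δ,
          (σ.restrictScalars ℚ) • R.ptQ L' ((Sg.pts L').symm (SiegelShimuraSet.mk δ L'.1 J a)) =
            R.ptQ L' ((Sg.pts L').symm (SiegelShimuraSet.mk δ L'.1 J (r * a))) := by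
  intro σ s hs r hr a
  rw [ptsSymm_mk_eq_map Sg f J a, ptsSymm_mk_eq_map Sg f J (r * a), ← R.map_ptQ f, ← R.map_ptQ f,
    ← AlgPoints.map_smul, h σ s hs r hr a]

/-! ### §3. `IsCanonical` ⇔ the law at a coinitial family of levels -/

/-- **HEAD — `IsCanonical` is the reciprocity law at any COINITIAL family of levels.**  If `S` is a set of principal levels such
that every level `L′` receives an arrow from some `L ∈ S` (`L ≤ L′`; e.g. `S = {K_δ(N) : N₀ ∣ N}`), then `R.IsCanonical` is
equivalent to the (62) clause of `IsCanonical` restricted to the levels in `S` (`⇒` specialisation; `⇐` `reciprocity_of_hom`).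
[cite: Deligne1971TravauxShimura, Déf. 3.1 p. 136, Déf. 3.13 p. 141] [cite: Milne2005ShimuraVarieties, Def. 12.8 (62) p. 114, Thm. 13.6 p. 118] -/
theorem isCanonical_iff_of_coinitial (S : Set (SiegelLevel δ)) (hS : ∀ L' : SiegelLevel δ, ∃ L ∈ S, Nonempty (L ⟶ L')) :
    R.IsCanonical ↔
      ∀ (ι : Type) [Fintype ι] [DecidableEq ι] (K : ι → Type) [∀ i, Field (K i)] [∀ i, NumberField (K i)]
        [∀ i, IsCMField (K i)] (c : CMStructure g δ ι K) (J : C0pm δ) (Φ : ∀ i, CMType (K i)), c.IsSpecial J Φ →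
        ∀ (E : IntermediateField ℚ ℂ) [FiniteDimensional ℚ ↥E], (∀ i, traceField (Φ i) ≤ E) →
          haveI : NumberField ↥E := NumberField.mk
          ∀ (σ : ℂ ≃ₐ[↥E] ℂ) (s : (FiniteAdeleRing (𝓞 ↥E) ↥E)ˣ),
            UnitaryCanonicalModel.IsArtinCorrespondent ↥E (algebraMap ↥E ℂ) s σ.toRingEquiv →
            ∀ r : gspFinAdelic δ,
              ((r : GL (Fin g ⊕ Fin g) (FiniteAdeleRing (𝓞 ℚ) ℚ)) :
                  Matrix (Fin g ⊕ Fin g) (Fin g ⊕ Fin g) (FiniteAdeleRing (𝓞 ℚ) ℚ)) = c.cmRecipMatrix Φ E s →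
              ∀ L ∈ S, ∀ (a : gspFinAdelic δ),
                (σ.restrictScalars ℚ) • R.ptQ L ((Sg.pts L).symm (SiegelShimuraSet.mk δ L.1 J a)) =
                  R.ptQ L ((Sg.pts L).symm (SiegelShimuraSet.mk δ L.1 J (r * a))) := by
  constructor
  · intro h ι _ _ K _ _ _ c J Φ hsp E _ hE σ s hs r hr L _ a
    exact h ι K c J Φ hsp E hE σ s hs r hr L a
  · intro h ι _ _ K _ _ _ c J Φ hsp E _ hE
    haveI : NumberField ↥E := NumberField.mk
    intro σ s hs r hr L' a
    obtain ⟨L, hL, ⟨f⟩⟩ := hS L'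
    exact R.reciprocity_of_hom c J Φ E f
      (fun σ s hs r hr a => h ι K c J Φ hsp E hE σ s hs r hr L hL a) σ s hs r hr a

/-- In particular the law at the levels `K_δ(N)` with `N₀ ∣ N` (any fixed `N₀ ≥ 1`) suffices: that family is coinitial
(`K_δ(N₀ N) ≤ K_δ(N)`, ★ `SiegelLevel.ofNat_le_ofNat`). [cite: Deligne1971TravauxShimura, 1.8 p. 129, Déf. 3.13 p. 141] -/
theorem coinitial_ofNat_dvd {N₀ : ℕ} (hN₀ : 0 < N₀) :
    ∀ L' : SiegelLevel δ, ∃ L ∈ {L : SiegelLevel δ | ∃ (N : ℕ) (hN : 3 ≤ N), N₀ ∣ N ∧ L = SiegelLevel.ofNat δ N hN},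
      Nonempty (L ⟶ L') := by
  intro L'
  have h3 : 3 ≤ N₀ * L'.N := le_trans L'.three_le_N (Nat.le_mul_of_pos_left _ hN₀)
  refine ⟨SiegelLevel.ofNat δ (N₀ * L'.N) h3, ⟨N₀ * L'.N, h3, dvd_mul_right _ _, rfl⟩, ⟨homOfLE ?_⟩⟩
  have hL' : L' = SiegelLevel.ofNat δ L'.N L'.three_le_N := Subtype.ext L'.val_eq
  conv_rhs => rw [hL']
  exact SiegelLevel.ofNat_le_ofNat _ _ (dvd_mul_left _ _)

end SiegelRationalModel

end Literature.AlgebraicGeometry.ModuliOfAbelianVarieties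

end
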